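import Mathlib.RingTheory.UniqueFactorizationDomain.Multiplicity
import Summits.ResolutionOfSingularities.ResolutionOfSingularities.Theorems.WeightedInvariantHypersurfaceLocalGameEFTDimOne
import HarnessLib

/-!
# The e.f.t. local weighted game (H2a′), curve move I: the chart `B = S[t⁻¹, πt]` and the saturated transform

Topic: `Summits/ResolutionOfSingularities/ResolutionOfSingularities/Theorems`. Helper (part 1 of 3) for the door item
`HypersurfaceCentreConstruction` (statement `stmt-ResolutionOfSingularities-19897`, route `WeightedInvariant`),
line `local-engine` v2 of `res-L1-w43-plan-1`; kernel K2 of the dim-2 design memo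
`L/res-type-098-w43/EFT-DIM2-DESIGN.md` (ORDER (o13)).

[OURS · L1 W4.3] Replaces the role of NO printed item; NOT a statement of the manuscript
[claim: Hironaka2017, status: under-review]. AI work, weaker than expert review.

Content: for the CURVE MOVE (only `π` positively weighted, weight `1`) the filtration is `𝒥ₙ = (πⁿ)`
(`weightedMonomialIdeal_single_eq`, `weightedMonomialIdeal_one_eq`), the algebra is `B = S[t⁻¹, πt]` with
generator `piT = πt`, local equation `π = t⁻¹·(πt)` (`algebraMap_pi_eq`), vertex ideal `⊆ (πt)`
(`vertexIdeal_le_span_piT`); and for `f = πᵉ f₂` with `π` prime, `π ∤ f₂`, every factorisation `f = t⁻ᵃ g` with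
`t⁻¹ ∤ g` has `a = e`, `g = (πt)ᵉ f₂` (`transform_eq`, by Laurent coefficients as in the dim-1 file).

## References

* J. Włodarczyk, *Functorial resolution by torus actions*, arXiv:2203.03090, Def. 2.3.5, §2.3.9. [Wlodarczyk2022]
-/

noncomputable section

open IsLocalRing Literature.AlgebraicGeometry.Resolution
open LaurentPolynomial
open scoped LaurentPolynomial
set_option linter.dupNamespace false -- mandated namespace of this single-conjunct summit

namespace Summit.ResolutionOfSingularities.ResolutionOfSingularities.Theorems

namespace LocalGameEFTCurveMove

variable {S : Type} [CommRing S]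


/-! ## The filtration of the curve move: `𝒥ₙ = (πⁿ)` -/

/-- The one-element chart `u = (π)`, `w = (1)` has `𝒥ₙ = (πⁿ)`. [folklore] -/
theorem weightedMonomialIdeal_one_eq (π : S) (m : ℕ) :
    weightedMonomialIdeal (fun _ : Fin 1 => π) (fun _ => 1) m = Ideal.span {π ^ m} := by
  refine le_antisymm (LocalGameEFTDimOne.weightedMonomialIdeal_one_le π m) ?_
  rw [Ideal.span_singleton_le_iff_mem]
  simpa using LocalGameEFTDimOne.mul_pow_mem_weightedMonomialIdeal_one π 1 (le_refl m)

/-- For a family `u` and the INDICATOR weight of `i₀` (`wᵢ = [i = i₀]`), `𝒥ₘ = (u i₀ ^ m)`. [folklore] -/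
theorem weightedMonomialIdeal_single_eq {d : ℕ} (u : Fin d → S) (i₀ : Fin d) (m : ℕ) :
    weightedMonomialIdeal u (Pi.single i₀ 1) m = Ideal.span {u i₀ ^ m} := by
  classical
  apply le_antisymm
  · rw [weightedMonomialIdeal, Ideal.span_le]
    rintro x ⟨α, hα, rfl⟩
    have hsum : ∑ i, Pi.single (M := fun _ => ℕ) i₀ 1 i * α i = α i₀ := by
      rw [Finset.sum_eq_single i₀ (fun j _ hj => by rw [Pi.single_eq_of_ne hj, zero_mul])
        (fun h => absurd (Finset.mem_univ i₀) h), Pi.single_eq_same, one_mul]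
    rw [hsum] at hα
    rw [SetLike.mem_coe, Ideal.mem_span_singleton,
      ← Finset.mul_prod_erase Finset.univ (fun i => u i ^ α i) (Finset.mem_univ i₀)]
    exact (pow_dvd_pow (u i₀) hα).trans (dvd_mul_right _ _)
  · rw [Ideal.span_singleton_le_iff_mem]
    refine Ideal.subset_span ⟨Pi.single i₀ m, ?_, ?_⟩
    · rw [Finset.sum_eq_single i₀ (fun j _ hj => by rw [Pi.single_eq_of_ne hj, zero_mul])
        (fun h => absurd (Finset.mem_univ i₀) h), Pi.single_eq_same, Pi.single_eq_same, one_mul]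
    · rw [Finset.prod_eq_single i₀ (fun j _ hj => by rw [Pi.single_eq_of_ne hj, pow_zero])
        (fun h => absurd (Finset.mem_univ i₀) h), Pi.single_eq_same]

/-- The two filtrations agree: `𝒥(u, [· = i₀]) = 𝒥((u i₀), (1))`. [folklore] -/
theorem weightedMonomialIdeal_single_eq_one {d : ℕ} (u : Fin d → S) (i₀ : Fin d) :
    weightedMonomialIdeal u (Pi.single i₀ 1) = weightedMonomialIdeal (fun _ : Fin 1 => u i₀) (fun _ => 1) := by
  funext m
  rw [weightedMonomialIdeal_single_eq, weightedMonomialIdeal_one_eq]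

/-! ## The chart `B = S[t⁻¹, πt]` of the curve move -/

section Chart

variable (π : S)

/-- `π ∈ 𝒥₁`. [folklore] -/
theorem pi_mem_one : π ∈ weightedMonomialIdeal (fun _ : Fin 1 => π) (fun _ => 1) 1 := by
  simpa using LocalGameEFTDimOne.mul_pow_mem_weightedMonomialIdeal_one π 1 (le_refl 1)

/-- The generator `πt` of `B = S[t⁻¹, πt]`. [folklore] -/
def piT : extReesAlgebra (weightedMonomialIdeal (fun _ : Fin 1 => π) (fun _ => 1)) :=
  ⟨C π * T ((1 : ℕ) : ℤ), extReesAlgebra.C_mul_T_mem _ Nat.one_pos (pi_mem_one π)⟩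

/-- `πt` as a Laurent polynomial. [folklore] -/
@[simp] theorem coe_piT :
    ((piT π : extReesAlgebra (weightedMonomialIdeal (fun _ : Fin 1 => π) (fun _ => 1))) : S[T;T⁻¹]) =
      C π * T ((1 : ℕ) : ℤ) := rfl

/-- The local equation of `B`: `π = t⁻¹ · (πt)`. [cite: Wlodarczyk2022, §2.3.9] -/
theorem algebraMap_pi_eq :
    algebraMap S (extReesAlgebra (weightedMonomialIdeal (fun _ : Fin 1 => π) (fun _ => 1))) π =
      extReesAlgebra.tInv _ * piT π := by
  apply Subtype.ext
  rw [Subalgebra.coe_algebraMap, ← C_eq_algebraMap, MulMemClass.coe_mul, extReesAlgebra.coe_tInv, coe_piT,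
    mul_left_comm, ← T_add, Nat.cast_one, neg_add_cancel, T_zero, mul_one]

/-- `c·πᵐ ↦ c · (πt)ᵐ · …`: in `B`, `algebraMap (c * π ^ m) = t⁻ᵐ · (algebraMap c * (πt)ᵐ)`. [folklore] -/
theorem algebraMap_mul_pow_eq (c : S) (m : ℕ) :
    algebraMap S (extReesAlgebra (weightedMonomialIdeal (fun _ : Fin 1 => π) (fun _ => 1))) (π ^ m * c) =
      extReesAlgebra.tInv _ ^ m * (piT π ^ m * algebraMap S _ c) := by
  rw [map_mul, map_pow, algebraMap_pi_eq, mul_pow, mul_assoc]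

/-- The vertex ideal of `B = S[t⁻¹, πt]` lies in `(πt)`. [cite: Wlodarczyk2022, Def. 2.3.5] -/
theorem vertexIdeal_le_span_piT :
    extReesAlgebra.vertexIdeal (weightedMonomialIdeal (fun _ : Fin 1 => π) (fun _ => 1)) ≤
      Ideal.span {piT π} := by
  have hE := stub_extReesAlgebra_weighted (fun _ : Fin 1 => π) (fun _ => 1)
  have h := vertexIdeal_le_span_u' (fun _ : Fin 1 => π) (fun _ => 1) hE (fun _ : Fin 1 => piT π)
    (fun _ => rfl) (fun _ => rfl)
  rwa [Set.range_const] at h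

/-- Off the vertex `πt` is invertible: `πt ∉ 𝔫` whenever `Vert ⊄ 𝔫`. [folklore] -/
theorem piT_not_mem {𝔫 : Ideal (extReesAlgebra (weightedMonomialIdeal (fun _ : Fin 1 => π) (fun _ => 1)))}
    (hV : ¬ extReesAlgebra.vertexIdeal (weightedMonomialIdeal (fun _ : Fin 1 => π) (fun _ => 1)) ≤ 𝔫) :
    piT π ∉ 𝔫 := fun hmem =>
  hV ((vertexIdeal_le_span_piT π).trans ((Ideal.span_singleton_le_iff_mem _).mpr hmem))

end Chart

/-! ## The saturated transform of `f = πᵉ f₂` is `(πt)ᵉ f₂` -/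

section Transform

variable [IsDomain S] {π : S} (hπ : Prime π)
include hπ

/-- If `f = πᵉ f₂` with `π ∤ f₂` and `f = t⁻ᵃ g` in `B` with `t⁻¹ ∤ g`, then `a = e` and `g = (πt)ᵉ f₂`.
[folklore] -/
theorem transform_eq {e : ℕ} {f₂ : S} (hf₂ : ¬ π ∣ f₂) {a : ℕ}
    {g : extReesAlgebra (weightedMonomialIdeal (fun _ : Fin 1 => π) (fun _ => 1))}
    (hfg : algebraMap S _ (π ^ e * f₂) =
      extReesAlgebra.tInv (weightedMonomialIdeal (fun _ : Fin 1 => π) (fun _ => 1)) ^ a * g)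
    (hndvd : ¬ extReesAlgebra.tInv (weightedMonomialIdeal (fun _ : Fin 1 => π) (fun _ => 1)) ∣ g) :
    a = e ∧ g = piT π ^ e * algebraMap S _ f₂ := by
  have hπ0 : π ≠ 0 := hπ.ne_zero
  -- `g = C(f) tᵃ`
  have hgval : (g : S[T;T⁻¹]) = C (π ^ e * f₂) * T (a : ℤ) := LocalGameEFTDimOne.coe_eq_C_mul_T_of_eq hfg
  have hcoeff : (g : S[T;T⁻¹]).coeff (a : ℤ) = π ^ e * f₂ := by
    rw [hgval, ← single_eq_C_mul_T, AddMonoidAlgebra.coeff_single, Finsupp.single_eq_same]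
  -- the `tᵃ`-coefficient lies in `𝒥ₐ = (πᵃ)`, so `a ≤ e`
  have hfa : π ^ e * f₂ ∈ Ideal.span {π ^ a} := by
    have h := InitialIdeal.coeff_mem_weightedMonomialIdeal (fun _ : Fin 1 => π) (fun _ => 1) g a
    rw [hcoeff] at h
    exact LocalGameEFTDimOne.weightedMonomialIdeal_one_le π a h
  have hae : a ≤ e := by
    by_contra hlt
    rw [not_le] at hlt
    rw [Ideal.mem_span_singleton] at hfa
    have h1 : π ^ (e + 1) ∣ π ^ e * f₂ := (pow_dvd_pow π hlt).trans hfa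
    rw [pow_succ, mul_dvd_mul_iff_left (pow_ne_zero e hπ0)] at h1
    exact hf₂ h1
  -- `a < e` would make `g` divisible by `t⁻¹`
  have hea : ¬ a < e := by
    intro hlt
    apply hndvd
    have hfI : π ^ e * f₂ ∈ weightedMonomialIdeal (fun _ : Fin 1 => π) (fun _ => 1) (a + 1) := by
      rw [mul_comm]
      exact LocalGameEFTDimOne.mul_pow_mem_weightedMonomialIdeal_one π f₂ hlt
    refine ⟨⟨C (π ^ e * f₂) * T ((a + 1 : ℕ) : ℤ), extReesAlgebra.C_mul_T_mem _ (Nat.succ_pos a) hfI⟩,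
      Subtype.ext ?_⟩
    rw [MulMemClass.coe_mul, extReesAlgebra.coe_tInv, hgval, mul_left_comm, ← T_add]
    congr 2
    push_cast
    ring
  have hae' : a = e := le_antisymm hae (not_lt.mp hea)
  refine ⟨hae', Subtype.ext ?_⟩
  rw [hgval, hae', MulMemClass.coe_mul, SubmonoidClass.coe_pow, Subalgebra.coe_algebraMap, ← C_eq_algebraMap,
    coe_piT, map_mul, map_pow, mul_pow, ← map_pow, T_pow, mul_assoc, mul_assoc]
  congr 1
  rw [mul_comm]
  congr 2
  push_cast
  ring

end Transform

end LocalGameEFTCurveMove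

end Summit.ResolutionOfSingularities.ResolutionOfSingularities.Theorems

end
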